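import Literature.NumberTheory.Transcendental.AssociatorsBaseChange

/-!
# `PentagonInKZ`, line `edge-normal-newton-leibniz`: corner engine — transfer of the residue identities from `U𝔞₄ ⊗ ℝ/(deg > N)` to `ℚ`-linear functionals

The hypotheses of the corner principle are identities in
`DrinfeldKohnoTrunc ℝ (Fin 4) N = U𝔞₄ ⊗ ℝ/(deg > N)` with real function coefficients, between the
images `Zr k` of elements `Zq k ∈ DrinfeldKohnoTrunc ℚ (Fin 4) N` under the base change
`DrinfeldKohnoTrunc.map (algebraMap ℚ ℝ)` (`DrinfeldKohnoTrunc.map_t`).  `cornerEngine_transfer`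
turns them into identities of real numbers for an arbitrary `ℚ`-linear functional `μ` on
`DrinfeldKohnoTrunc ℚ (Fin 4) N` and arbitrary context factors `P`, `Q`:

* the commutator `[Zq 0, Zq 1]` vanishes already over `ℚ`, by injectivity of the base change
  along `ℚ → ℝ` (`DrinfeldKohnoTrunc.map_injective`);
* a relation `∑ c_s • map (x_s) = 0` in `DK_N(ℝ)` with real coefficients `c_s` gives
  `∑ c_s * μ (P * x_s * Q) = 0` (`CornerEngineTransfer.sum_mul_cast_eq_zero`): multiply by
  `map P`, `map Q`, push through the comparison map
  `DrinfeldKohnoTrunc.toModel : DK_N(ℝ) → ℝ ⊗_ℚ DK_N(ℚ)` (`DK_N(ℝ)` is the base change of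
  `DK_N(ℚ)`, the relations being defined over `ℚ` [Furusho2011, §2]), where it reads
  `∑ c_s ⊗ (P x_s Q) = 0` (`CornerEngineTransfer.toModel_map_algebraMap`), and apply the
  `ℚ`-linear functional `ℝ ⊗ μ : ℝ ⊗_ℚ DK_N(ℚ) → ℝ ⊗_ℚ ℚ = ℝ`.

No analysis is involved: the letter densities `fd`, `gd` are arbitrary functions here.
-/

noncomputable section

open Literature.NumberTheory.Transcendental
open scoped TensorProduct

namespace Summit.KontsevichZagierPeriods.FurushoPentagon.PentagonInKZ

namespace CornerEngineTransfer

/-- The comparison map `toModel` sends the base change `map (algebraMap ℚ ℝ) x` of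
`x ∈ DK_N(ℚ)` to `1 ⊗ x` (checked on scalars, generators, sums and products). [folklore] -/
theorem toModel_map_algebraMap {ι : Type*} (N : ℕ) (x : DrinfeldKohnoTrunc ℚ ι N) :
    DrinfeldKohnoTrunc.toModel ℝ ι N (DrinfeldKohnoTrunc.map (algebraMap ℚ ℝ) x) =
      (1 : ℝ) ⊗ₜ[ℚ] x := by
  induction x using DrinfeldKohnoTrunc.induction_on' ℚ ι N with
  | halg r =>
    rw [DrinfeldKohnoTrunc.map_algebraMap, AlgHom.commutes, Algebra.TensorProduct.algebraMap_apply,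
      Algebra.algebraMap_self, RingHom.id_apply, Algebra.algebraMap_eq_smul_one,
      Algebra.algebraMap_eq_smul_one, TensorProduct.smul_tmul]
  | ht i j => rw [DrinfeldKohnoTrunc.map_t, DrinfeldKohnoTrunc.toModel_t]
  | hadd x y hx hy => rw [map_add, map_add, hx, hy, TensorProduct.tmul_add]
  | hmul x y hx hy => rw [map_mul, map_mul, hx, hy, Algebra.TensorProduct.tmul_mul_tmul, mul_one]

/-- **Transfer of a linear relation with real coefficients.**  If `∑ c_s • map (x_s) = 0` in
`DK_N(ℝ)` with `c_s ∈ ℝ` and `x_s ∈ DK_N(ℚ)`, then `∑ c_s * μ (P * x_s * Q) = 0` in `ℝ` for every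
`ℚ`-linear functional `μ` on `DK_N(ℚ)` and all `P Q ∈ DK_N(ℚ)` (push through `toModel` and
`ℝ ⊗ μ`). [folklore] -/
theorem sum_mul_cast_eq_zero {σ : Type*} [Fintype σ] {N : ℕ} (c : σ → ℝ)
    (x : σ → DrinfeldKohnoTrunc ℚ (Fin 4) N)
    (h : ∑ s, c s • DrinfeldKohnoTrunc.map (algebraMap ℚ ℝ) (x s) = 0)
    (μ : DrinfeldKohnoTrunc ℚ (Fin 4) N →ₗ[ℚ] ℚ) (P Q : DrinfeldKohnoTrunc ℚ (Fin 4) N) :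
    ∑ s, c s * (μ (P * x s * Q) : ℝ) = 0 := by
  -- insert the context factors
  have h1 : ∑ s, c s • DrinfeldKohnoTrunc.map (algebraMap ℚ ℝ) (P * x s * Q) = 0 := by
    have h0 := congrArg (fun z => DrinfeldKohnoTrunc.map (algebraMap ℚ ℝ) P * z *
      DrinfeldKohnoTrunc.map (ι := Fin 4) (N := N) (algebraMap ℚ ℝ) Q) h
    simpa only [Finset.mul_sum, Finset.sum_mul, mul_smul_comm, smul_mul_assoc, map_mul, mul_zero,
      zero_mul, mul_assoc] using h0
  -- push through the comparison map `DK_N(ℝ) → ℝ ⊗_ℚ DK_N(ℚ)`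
  have h2 : ∑ s, c s ⊗ₜ[ℚ] (P * x s * Q) = (0 : ℝ ⊗[ℚ] DrinfeldKohnoTrunc ℚ (Fin 4) N) := by
    have h0 := congrArg (DrinfeldKohnoTrunc.toModel ℝ (Fin 4) N) h1
    rw [map_sum, map_zero] at h0
    rw [← h0]
    refine Finset.sum_congr rfl fun s _ => ?_
    rw [map_smul, toModel_map_algebraMap, TensorProduct.smul_tmul', smul_eq_mul, mul_one]
  -- apply `ℝ ⊗ μ : ℝ ⊗ DK_N(ℚ) → ℝ ⊗ ℚ = ℝ`
  have h3 := congrArg ((TensorProduct.rid ℚ ℝ).toLinearMap ∘ₗ LinearMap.lTensor ℝ μ) h2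
  rw [map_sum, map_zero] at h3
  simpa only [LinearMap.coe_comp, Function.comp_apply, LinearMap.lTensor_tmul,
    LinearEquiv.coe_coe, TensorProduct.rid_tmul, Rat.smul_def, mul_comm (c _)] using h3

end CornerEngineTransfer

/-- **Corner engine, transfer step.**  The residue identities of the corner principle — the
commutation `[Zr 0, Zr 1] = 0`, flatness `∑_{k,l} fd_k gd_l • [Zr k, Zr l] = 0` on the open
rectangle `(0, α) × (0, β)`, and the two edge centralities — hold in
`DK_N(ℝ) = U𝔞₄ ⊗ ℝ/(deg > N)` for the base changes `Zr k = ∑ nZ k i j • t_ij` of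
`Zq k ∈ DK_N(ℚ)`; they transfer to every `ℚ`-linear functional `μ` on `DK_N(ℚ)` with arbitrary
context factors `P`, `Q`: `μ (P [Zq 0, Zq 1] Q) = 0` (the commutator vanishes over `ℚ` by
injectivity of `DK_N(ℚ) → DK_N(ℝ)`), and the three sums vanish with `μ (P [Zq k, Zq l] Q)` in
place of `[Zr k, Zr l]` (base change `DK_N(ℝ) = ℝ ⊗_ℚ DK_N(ℚ)` followed by `ℝ ⊗ μ`).
[cite: Furusho2011, §2] -/
theorem cornerEngine_transfer :
    ∀ (m : ℕ) (cf : Fin (m + 2) → Fin 4 → ℚ) (α β : ℚ) (N : ℕ) (nZ : Fin (m + 2) → Fin 4 → Fin 4 → ℤ) (fd : Fin (m + 2) → ℝ → ℝ → ℝ) (hfd : ∀ k t y, fd k t y = ((cf k 1 : ℝ) + (cf k 3 : ℝ) * y) / ((cf k 0 : ℝ) + (cf k 1 : ℝ) * t + (cf k 2 : ℝ) * y + (cf k 3 : ℝ) * t * y)) (gd : Fin (m + 2) → ℝ → ℝ → ℝ) (hgd : ∀ k x s, gd k x s = ((cf k 2 : ℝ) + (cf k 3 : ℝ) * x) / ((cf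 k 0 : ℝ) + (cf k 1 : ℝ) * x + (cf k 2 : ℝ) * s + (cf k 3 : ℝ) * x * s)) (Zr : Fin (m + 2) → DrinfeldKohnoTrunc ℝ (Fin 4) N) (hZr : ∀ k, Zr k = ∑ i : Fin 4, ∑ j : Fin 4, (nZ k i j : ℝ) • DrinfeldKohnoTrunc.t ℝ N i j), Zr 0 * Zr 1 = Zr 1 * Zr 0 → (∀ x y : ℝ, 0 < x → x < (α : ℝ) → 0 < y → y < (β : ℝ) → ∑ k : Fin (m + 2), ∑ l : Fin (m + 2), (fd k x y * gd l x y) • (Zr k * Zr l - Zr l * Zr k) = 0) → (∀ y : ℝ, 0 < y → y < (β : ℝ) → ∑ l : Fin (m + 2), gd l 0 y • (Zr 0 * Zr l - Zr l * Zr 0) = 0) → (∀ x : ℝ, 0 < x → x < (α : ℝ) → ∑ k : Fin (m + 2), fd k x 0 • (Zr 1 * Zr k - Zr k * Zr 1) = 0) → ∀ (Zq : Fin (m + 2) → DrinfeldKohnoTrunc ℚ (Fin 4) N), (∀ k, Zq k = (∑ i : Fin 4, ∑ j : Fin 4, (nZ k i j : ℚ) • DrinfeldKohnoTrunc.t ℚ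 N i j)) → ∀ (μ : DrinfeldKohnoTrunc ℚ (Fin 4) N →ₗ[ℚ] ℚ) (P Q : DrinfeldKohnoTrunc ℚ (Fin 4) N), (μ (P * (Zq 0 * Zq 1 - Zq 1 * Zq 0) * Q) = 0) ∧ (∀ x y : ℝ, 0 < x → x < (α : ℝ) → 0 < y → y < (β : ℝ) → ∑ k : Fin (m + 2), ∑ l : Fin (m + 2), (fd k x y * gd l x y) * (μ (P * (Zq k * Zq l - Zq l * Zq k) * Q) : ℝ) = 0) ∧ (∀ y : ℝ, 0 < y → y < (β : ℝ) → ∑ l : Fin (m + 2), gd l 0 y * (μ (P * (Zq 0 * Zq l - Zq l * Zq 0) * Q) : ℝ) = 0) ∧ (∀ x : ℝ, 0 < x → x < (α : ℝ) → ∑ k : Fin (m + 2), fd k x 0 * (μ (P * (Zq 1 * Zq k - Zq k * Zq 1) * Q) : ℝ) = 0) := by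
  intro m cf α β N nZ fd _ gd _ Zr hZr hcomm hflat hcentV hcentH Zq hZq μ P Q
  -- `Zr k` is the base change of `Zq k`
  have hZ : ∀ k, Zr k = DrinfeldKohnoTrunc.map (algebraMap ℚ ℝ) (Zq k) := by
    intro k
    rw [hZr, hZq]
    simp only [map_sum, DrinfeldKohnoTrunc.map_smul, DrinfeldKohnoTrunc.map_t, eq_ratCast,
      Rat.cast_intCast]
  have hZc : ∀ k l, Zr k * Zr l - Zr l * Zr k =
      DrinfeldKohnoTrunc.map (algebraMap ℚ ℝ) (Zq k * Zq l - Zq l * Zq k) := by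
    intro k l
    rw [map_sub, map_mul, map_mul, hZ, hZ]
  refine ⟨?_, ?_, ?_, ?_⟩
  · -- the commutator vanishes over `ℚ`
    have h0 : Zq 0 * Zq 1 - Zq 1 * Zq 0 = 0 := by
      apply DrinfeldKohnoTrunc.map_injective (Fin 4) N (algebraMap ℚ ℝ).injective
      rw [← hZc, map_zero, sub_eq_zero]
      exact hcomm
    rw [h0, mul_zero, zero_mul, map_zero]
  · intro x y hx hxα hy hyβ
    have h := hflat x y hx hxα hy hyβ
    have key := CornerEngineTransfer.sum_mul_cast_eq_zero
      (fun p : Fin (m + 2) × Fin (m + 2) => fd p.1 x y * gd p.2 x y)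
      (fun p => Zq p.1 * Zq p.2 - Zq p.2 * Zq p.1) ?_ μ P Q
    · simpa only [Fintype.sum_prod_type] using key
    · rw [Fintype.sum_prod_type]
      simpa only [hZc] using h
  · intro y hy hyβ
    have h := hcentV y hy hyβ
    simp only [hZc] at h
    exact CornerEngineTransfer.sum_mul_cast_eq_zero _ _ h μ P Q
  · intro x hx hxα
    have h := hcentH x hx hxα
    simp only [hZc] at h
    exact CornerEngineTransfer.sum_mul_cast_eq_zero _ _ h μ P Q

end Summit.KontsevichZagierPeriods.FurushoPentagon.PentagonInKZ
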